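import Summits.BirchSwinnertonDyer.BirchSwinnertonDyer.Theorems.SignedLowerHalvesKobayashiMainConjectureSmallImageLambdaTransferCM
import Summits.BirchSwinnertonDyer.BirchSwinnertonDyer.Theorems.SignedLowerHalvesKobayashiLowerHalfLargeImageCongruencePlaces
import Summits.BirchSwinnertonDyer.BirchSwinnertonDyer.Theorems.SignedLowerHalvesKobayashiLowerHalfLargeImageCongruencePlacesGood
import Summits.BirchSwinnertonDyer.BirchSwinnertonDyer.Theorems.SignedLowerHalvesKobayashiMainConjectureSmallImageCMTransferRecordsE
import Literature.NumberTheory.EllipticCurves.Fisher2012.HesseFamilyFiveClosedForms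
import Literature.NumberTheory.EllipticCurves.Fisher2012.HesseFamilyFiveIndClosedForms
import HarnessLib

/-!
# Route `SignedLowerHalves`, crux `KobayashiMainConjectureSmallImage` (item stmt-BirchSwinnertonDyer-19002):
# small-image congruence road («L4-λ») — RECORDS «L4LAM-r3» part D: `105408z1 @ 5` (cell `bsd-ssimc`, seat `bsd-ssimc-k3-c4` gen 12;
# a `--supports stmt-BirchSwinnertonDyer-19002 --as helper` file; closes nothing about the crux)

PARTITION (cell bsd-ssimc): X7 (A7) × `105408z1 @ 5` — per-pair records (Kobayashi's signed main conjecture for the listed sign(s) and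
`BSD(E,5)`, from PUBLISHED facts + displayed certificates); the crux `KobayashiMainConjectureSmallImage` stays OPEN; 0 census moves are
booked here (desk keys are the planner's to file); BSD is not proved by any of this. THEOREMS ONLY.

## Provenance («L4LAM-r3», k3c4-MEMO-11)

These are item-4 window pairs (X7, good supersingular `5` with `a_5 = 0`, NON-surjective mod-5 image = normaliser of a non-split Cartan,
`r_an = 0`) whose CM shadow field is `ℚ(√−3)` and whose CM ELLIPTIC partner `A : y² = x³ + B` (`j = 0`, `5` inert) was found and
KERNEL-CERTIFIED 5-congruent to `E` by the seat's gen 0/2 (`cm_congruence_probe.tsv`; Fisher Hesse-pencil identity by `norm_num`). They carry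
per-pair `KobayashiMainConjecture W 5 ε` theorems since gen 2 (L4-CM, modulo the PRE binder `CorpuzLei2025_…_OPEN`) and gen 4 (L4-PUB, which
CONSUMES `BSD(E,5)` from the b2b lane's full-5-descent theorem `bsdp_s<label>` — tier [GRH] for the class group of the 24-ic 5-division field),
and are therefore still `residue` with the single open cell `(5,'X7')` on referee A's ledger (state after ROUND 662, sha16 89410861d70c61c4).
This file runs them on g6's λ-road instead (`…LambdaTransferCM.lean` p473173, REPORT-k3c4-7 PASS; template = g8/g9 «L4LAM-r2» parts B/E,
booked 4/4 → PROVED at A ROUND 614): `SmallImageCongruenceRoad.kobayashiMainConjecture_{neg_one,one}_of_cmPartner_of_mazurTate` — partner MC =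
Pollack–Rubin 2004 BY NAME (`hPR`), Kim 2009 μ- and λ-transfer BY NAME (`h09`, `hKim`), Kobayashi Thm. 1.2 / 4.1-rational (`h12`, `h41`), period
units (`h5`, `h3`), modularity (`hmod`), Pollack (`hPollack`), Fisher 2012 Thm. 13.2 (`hF`) / Fisher 2013 Thm. 5.8 (`hF'`); per pair the DISPLAYED
certificate rows (two engines agreeing: B = b2b msengine `MSENGINE_SHA256SUMS`, T = iw-2 `engT.py` d8b96ce8, A = PARI `engineA.py` a8b8e893,
byte-identical re-uses, kit j275540 `--workitem …19002`; E-side layer-1 rows also b2b `b2b-bsdres-iw-2/tables/engT_layers.tsv` CERTIFIED+AGREE) as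
`(hΘ, hΘ0, hμ, hlam)` quadruples, and the KERNEL-DECIDED δ-bookkeeping (`places_<label>_5`, toolkit `…LargeImageCongruencePlaces(.Good).lean`
p467415). Then `BSDp W 5` through the IMAGE-FREE rank-0 road `bsdp_of_kobayashiMainConjecture_of_analyticRank_eq_zero` with `hr : r_an = 0`
displayed. NO `Surj`, NO `BSD(E,5)` input, NO descent certificate, NO GRH, NO preprint, NO Mazur–Tate congruence `hMT`.

* `105408z1` (Cremona model `[0, 0, 0, -19194180, 32367000792]`, `r_an = 0`, image `5Nn`): partner `A = cm0m32` = `[0, 0, 0, 0, -32]` (`y² = x³ + (-32)`-type CM curve, `j = 0`, CM by `ℤ[ζ₃]`; `5` inert in `ℚ(√−3)` ⇒ `a_5 = 0`); kernel data `card_c105408z1_5` / `card_cm0m32_5` / `hasCM_cm0m32` and the Hesse certificate `(-96 : 1)`, `u = 1019215872` (direct pencil, `hF`) are those of the LANDED record in `SignedLowerHalvesKobayashiMainConjectureSmallImageCMTransferRecordsE.lean` (imported, not restated); δ-bookkeeping `Σδ_E = 0`, `Σδ_A = 0` over `Σ₀ = {2, 3, 61}`.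

References: [Kobayashi2003] Conj. (p. 2), Thm. 1.2, 4.1; [BDKim2009] Cor. 2.13, 2.5, Prop. 2.6; [PollackRubin2004] Thm. (p. 448);
[Pollack2003] Def. 6.15, Prop. 6.9/6.10/6.18; [Fisher2012Hessian] Thm. 13.2, §13; [Fisher2013QuinticTwists] Thm. 5.8; [GreenbergVatsal2000]
Prop. (2.4); [BDKim2013] Cor. 3.15; [Cremona2006] Table 1; [SilvermanAEC2009] V §2, VII.5, App. C §11. Memo: `HOME/k3c4-MEMO-11.md`.
-/

set_option autoImplicit false
set_option linter.dupNamespace false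
noncomputable section

open scoped Classical MatrixGroups ModularForm BigOperators

open CongruenceSubgroup WeierstrassCurve NumberField IsDedekindDomain Rat.HeightOneSpectrum
  Literature.NumberTheory.EllipticCurves
  Literature.NumberTheory.EllipticCurves.ModularForms
  Literature.NumberTheory.EllipticCurves.Rank1Residual
  Literature.NumberTheory.EllipticCurves.Rank1Residual.Typed
  Literature.NumberTheory.EllipticCurves.Kobayashi2003 ZpExtension
  Literature.NumberTheory.EllipticCurves.GreenbergVatsal2000
  Literature.NumberTheory.EllipticCurves.BDKim2009
  Literature.NumberTheory.EllipticCurves.Fisher2012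
  Literature.NumberTheory.EllipticCurves.Rank1Residual.X11RankOneCertificates
  Literature.NumberTheory.GaloisRepresentations
  Summit.BirchSwinnertonDyer.Rank1Residual.X1.MuLambda
  Summit.BirchSwinnertonDyer.Rank1Residual.Supersingular
  Summit.BirchSwinnertonDyer.Rank1Residual.X2.LocalDeltaCalculus
  Summit.BirchSwinnertonDyer.BirchSwinnertonDyer.Rank1Residual.IntModel
  Summit.BirchSwinnertonDyer.BirchSwinnertonDyer.Rank1Residual.X11RankOne
  Summit.BirchSwinnertonDyer.Rank1Residual.X11b
  Summit.BirchSwinnertonDyer.Rank1Residual.X9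
  Summit.BirchSwinnertonDyer.Rank1Residual.X1
  Summit.BirchSwinnertonDyer.BirchSwinnertonDyer.Theorems.CongruenceRoad

namespace Summit.BirchSwinnertonDyer.BirchSwinnertonDyer.Theorems.SmallImageCongruenceRoad

/-! ### Pair `105408z1 @ 5` — kernel data (δ-bookkeeping) -/

/-- `#(𝔽_61)`-point count `49` of `[0, 0, 0, 0, -32]` (the CM partner A of the pair `105408z1 @ 5`; fast count, kernel). [cite: SilvermanAEC2009, V §2] -/
theorem countPoints_105408z1_5_A_61 : countPoints [0, 0, 0, 0, -32] 61 = (49 : ℕ) :=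
  countPoints_eq_of_fast (by decide +kernel)

/-- **The δ-bookkeeping of `(105408z1, A = cm0m32)` at `5`, KERNEL-DECIDED**: with `Σ₀` the places over `{2, 3, 61}` (away from
`5`, containing every bad place of both curves), `Σ_{Σ₀} δ_E = 0` and `Σ_{Σ₀} δ_A = 0` (ℓ = 2: E additive; ℓ = 2: A additive; ℓ = 3: E additive; ℓ = 3: A additive; ℓ = 61: E nonsplit; ℓ = 61: A good_ndvd).
[cite: GreenbergVatsal2000, §2 Prop. (2.4) (p. 22)] [cite: SilvermanAEC2009, VII.5 Prop. 5.1] -/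
theorem places_105408z1_5 (W A : WeierstrassCurve ℚ) [W.IsElliptic] [W.IsGloballyMinimal]
    [A.IsElliptic] [A.IsGloballyMinimal]
    (hW : W = ⟨0, 0, 0, -19194180, 32367000792⟩) (hA : A = ⟨0, 0, 0, 0, -32⟩) :
    ∃ S₀ : Finset (HeightOneSpectrum (𝓞 ℚ)), (∀ v ∈ S₀, ((5 : ℕ) : 𝓞 ℚ) ∉ v.asIdeal) ∧
      (∀ v : HeightOneSpectrum (𝓞 ℚ), ¬ W.HasGoodReductionAt v → v ∈ S₀) ∧
      (∀ v : HeightOneSpectrum (𝓞 ℚ), ¬ A.HasGoodReductionAt v → v ∈ S₀) ∧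
      ∑ v ∈ S₀, delta W 5 v = 0 ∧ ∑ v ∈ S₀, delta A 5 v = 0 := by
  have hI : integralModelInt W = ⟨0, 0, 0, -19194180, 32367000792⟩ :=
    integralModelInt_eq_of_map_eq _ (by rw [hW]; ext <;> simp [WeierstrassCurve.map])
  have hI' : integralModelInt A = ⟨0, 0, 0, 0, -32⟩ :=
    integralModelInt_eq_of_map_eq _ (by rw [hA]; ext <;> simp [WeierstrassCurve.map])
  set v2 : HeightOneSpectrum (𝓞 ℚ) := (primesEquiv (R := 𝓞 ℚ)).symm ⟨2, Nat.prime_two⟩ with hv2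
  set v3 : HeightOneSpectrum (𝓞 ℚ) := (primesEquiv (R := 𝓞 ℚ)).symm ⟨3, by norm_num⟩ with hv3
  set v61 : HeightOneSpectrum (𝓞 ℚ) := (primesEquiv (R := 𝓞 ℚ)).symm ⟨61, by norm_num⟩ with hv61
  have d2 : delta W 5 v2 = 0 :=
    delta_eq_zero_of_dvd_of_dvd hI 5 v2 (by rw [hv2, natGenerator_symm]; decide)
      (by rw [hv2, natGenerator_symm]; decide)
  have d3 : delta W 5 v3 = 0 :=
    delta_eq_zero_of_dvd_of_dvd hI 5 v3 (by rw [hv3, natGenerator_symm]; decide)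
      (by rw [hv3, natGenerator_symm]; decide)
  have d61 : delta W 5 v61 = 0 := by
    rw [delta_eq_of_nonsplit hI 5 v61 61 (by norm_num) (by rw [hv61, natGenerator_symm]) (by decide) (by decide)
      (by decide +kernel), sFactor_eq_of_eq_pow_mul (k := 0) (m := 2769168) (by norm_num) (by norm_num)]
    decide
  have e2 : delta A 5 v2 = 0 :=
    delta_eq_zero_of_dvd_of_dvd hI' 5 v2 (by rw [hv2, natGenerator_symm]; decide)
      (by rw [hv2, natGenerator_symm]; decide)
  have e3 : delta A 5 v3 = 0 :=
    delta_eq_zero_of_dvd_of_dvd hI' 5 v3 (by rw [hv3, natGenerator_symm]; decide)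
      (by rw [hv3, natGenerator_symm]; decide)
  have e61 : delta A 5 v61 = 0 :=
    delta_eq_zero_of_good_of_not_dvd_count hI' 5 v61 61 (by norm_num) (by rw [hv61, natGenerator_symm]) (by norm_num)
      (by norm_num) rfl (by decide) countPoints_105408z1_5_A_61 (by decide)
  have n1 : v2 ∉ ({v3, v61} : Finset (HeightOneSpectrum (𝓞 ℚ))) := by
    simp only [Finset.mem_insert, Finset.mem_singleton, hv2, hv3, hv61, not_or]
    exact ⟨symm_ne_symm _ _ (by norm_num), symm_ne_symm _ _ (by norm_num)⟩
  have n2 : v3 ∉ ({v61} : Finset (HeightOneSpectrum (𝓞 ℚ))) := by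
    simp only [Finset.mem_singleton, hv3, hv61]
    exact symm_ne_symm _ _ (by norm_num)
  refine ⟨{v2, v3, v61}, ?_, ?_, ?_, ?_, ?_⟩
  · intro v hv
    simp only [Finset.mem_insert, Finset.mem_singleton] at hv
    rcases hv with rfl | rfl | rfl
    · exact natCast_not_mem_symm (by norm_num) _ (by norm_num)
    · exact natCast_not_mem_symm (by norm_num) _ (by norm_num)
    · exact natCast_not_mem_symm (by norm_num) _ (by norm_num)
  · -- `Σ₀ ⊇` bad places of `E`: `Δ(E) = -(2 ^ 10 * 3 ^ 3 * 61 ^ 5)`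
    intro v hv
    by_contra hvS
    apply hv
    apply hasGoodReductionAt_of_not_dvd hI
    intro hdvd
    have hΔ : (⟨0, 0, 0, -19194180, 32367000792⟩ : WeierstrassCurve ℤ).Δ = -(2 ^ 10 * 3 ^ 3 * 61 ^ 5) := by
      decide
    rw [hΔ, dvd_neg] at hdvd
    have hpr := prime_natGenerator v
    have h' : natGenerator v ∣ 2 ^ 10 * 3 ^ 3 * 61 ^ 5 := by exact_mod_cast hdvd
    have key : natGenerator v = 2 ∨ natGenerator v = 3 ∨ natGenerator v = 61 := by
      rcases (Nat.Prime.dvd_mul hpr).mp h' with h | h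
      · rcases (Nat.Prime.dvd_mul hpr).mp h with h | h
        · exact Or.inl ((Nat.prime_dvd_prime_iff_eq hpr Nat.prime_two).mp (hpr.dvd_of_dvd_pow h))
        · exact Or.inr (Or.inl ((Nat.prime_dvd_prime_iff_eq hpr (by norm_num)).mp (hpr.dvd_of_dvd_pow h)))
      · exact Or.inr (Or.inr ((Nat.prime_dvd_prime_iff_eq hpr (by norm_num)).mp (hpr.dvd_of_dvd_pow h)))
    apply hvS
    simp only [Finset.mem_insert, Finset.mem_singleton]
    rcases key with h | h | h
    · exact Or.inl (eq_symm_of_natGenerator_eq Nat.prime_two h)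
    · exact Or.inr (Or.inl (eq_symm_of_natGenerator_eq (by norm_num) h))
    · exact Or.inr (Or.inr (eq_symm_of_natGenerator_eq (by norm_num) h))
  · -- `Σ₀ ⊇` bad places of `A`: `Δ(A) = -(2 ^ 14 * 3 ^ 3)`
    intro v hv
    by_contra hvS
    apply hv
    apply hasGoodReductionAt_of_not_dvd hI'
    intro hdvd
    have hΔ : (⟨0, 0, 0, 0, -32⟩ : WeierstrassCurve ℤ).Δ = -(2 ^ 14 * 3 ^ 3) := by
      decide
    rw [hΔ, dvd_neg] at hdvd
    have hpr := prime_natGenerator v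
    have h' : natGenerator v ∣ 2 ^ 14 * 3 ^ 3 := by exact_mod_cast hdvd
    have key : natGenerator v = 2 ∨ natGenerator v = 3 := by
      rcases (Nat.Prime.dvd_mul hpr).mp h' with h | h
      · exact Or.inl ((Nat.prime_dvd_prime_iff_eq hpr Nat.prime_two).mp (hpr.dvd_of_dvd_pow h))
      · exact Or.inr ((Nat.prime_dvd_prime_iff_eq hpr (by norm_num)).mp (hpr.dvd_of_dvd_pow h))
    apply hvS
    simp only [Finset.mem_insert, Finset.mem_singleton]
    rcases key with h | h
    · exact Or.inl (eq_symm_of_natGenerator_eq Nat.prime_two h)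
    · exact Or.inr (Or.inl (eq_symm_of_natGenerator_eq (by norm_num) h))
  · norm_num [Finset.sum_insert n1, Finset.sum_insert n2, Finset.sum_singleton, d2, d3, d61]
  · norm_num [Finset.sum_insert n1, Finset.sum_insert n2, Finset.sum_singleton, e2, e3, e61]

/-! ### Pair `105408z1 @ 5` — the records -/

/-- **`lam4_105408z1_5` — Kobayashi's main conjecture for `(105408z1, 5, ε)`, EITHER sign, AT THE PAIR by the small-image
congruence road with the CM partner `A = cm0m32` = `[0, 0, 0, 0, -32]` (`y² = x³ + (-32)`-type CM curve, `j = 0`, CM by `ℤ[ζ₃]`; `5` inert in `ℚ(√−3)` ⇒ `a_5 = 0`) — NO preprint, NO `Surj`, NO `BSD(E,5)` input, NO Mazur–Tate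
congruence `hMT`.** Desk cell: `residue; [(5,'X7')]` (OPEN) on referee A's newest state `scratchA_A_state_after_jsw17addC_onR662_fold.pkl` sha16 89410861d70c61c4 (read-only look-up 2026-08-27T09:50Z). Certificates DISPLAYED as
hypotheses (kit j275540, engines byte-identical re-uses: B = b2b msengine `MSENGINE_SHA256SUMS`, T = iw-2 `engT.py` d8b96ce8, A = PARI `ellpadiclambdamu` via
`engineA.py` a8b8e893; E-side rows also b2b `tables/engT_layers.tsv` where marked): ε = -1: E row θ_1 (λ = deg ω_1^+ + 0), A row θ_1 (λ = deg + 0); ε = 1: E row θ_2 (λ = deg ω_2^− + 0), A row θ_2 (λ = deg + 0). Rows (kit j275540, `--workitem …19002`, evidence auto-attached; E layer-1 row also b2b `b2b-bsdres-iw-2/tables/engT_layers.tsv` 105408z1@5 CERTIFIED+AGREE): ε = −1: E θ_1: λ = 0 — engine T CERTIFIED (V = 0, μ = 0), engine B (μ, λ) = (0, 0) with q_1 = 0 AGREE; A θ_1: λ = 0 — engine T CERTIFIED (V = 0, μ = 0), engine B (μ, λ) = (0, 0) with q_1 = 0 AGREE | ε = +1: E θ_2: λ = 4 — engine T CERTIFIED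 (V = 4, μ = 0), engine B (μ, λ) = (0, 4) with q_2 = 4 AGREE; A θ_2: λ = 4 — engine T CERTIFIED (V = 4, μ = 0), engine B (μ, λ) = (0, 4) with q_2 = 4 AGREE. Partner `cm0m32`: N_A = 1728, r_an(A) = 0 (engine A); engine A `ellpadiclambdamu(A,5)` = [[0, 0], [0, 0]] (PARI labelling [[λ⁺,λ⁻],[μ⁺,μ⁻]]). The `5`-congruence is KERNEL-CHECKED
(`E` ≅ the member `(-96 : 1)` of Fisher's pencil `X_A(5)` (Fisher 2012 Thm 13.2, `hF`), `u = 1019215872` — the SAME certificate as the landed L4-CM record `kobayashiMainConjecture_c105408z1_5_of_…` (SignedLowerHalvesKobayashiMainConjectureSmallImageCMTransferRecordsE.lean), identities re-checked here by `norm_num`); the δ-bookkeeping `l_E + 0 = l_A + 0` is `places_105408z1_5` (kernel); `a_5 = 0` for both curves and the CM of `A` are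
decided in the kernel. Published inputs BY NAME (`h12 h41 h5 h3 h09 hKim hPR hmod hPollack` hF). PER PAIR; crux 4 stays OPEN; nothing booked;
BSD is not proved by any of this.
[cite: Kobayashi2003, Conjecture (p. 2), Thm. 1.2 and Thm. 4.1] [cite: BDKim2009, Cor. 2.13, Cor. 2.5 and Prop. 2.6 (pp. 185–187)]
[cite: PollackRubin2004, Theorem (p. 448) = Thm. 7.3] [cite: Pollack2003, Def. 6.15, Prop. 6.9, 6.10 and 6.18]
[cite: Fisher2012Hessian, Thm. 13.2 and §13] [cite: GreenbergVatsal2000, §2 Prop. (2.4)] [cite: Cremona2006, Table 1 (Cremona label 105408z1)] -/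
theorem lam4_kobayashiMainConjecture_105408z1_5
    (h12 : Kobayashi2003.thm12_signedSelmerDual_finite_torsion)
    (h41 : Kobayashi2003.thm41_signedCharIdeal_divisibility)
    (h5 : realPeriodRat_eq_unit_mul_plusPeriod) (h3 : realPeriodRat_eq_unit_mul_plusPeriod_three)
    (h09 : cor213_signedMu_eq_zero_iff_of_torsionIso)
    (hKim : BDKim2009.cor213_signedLambda_add_sum_delta_eq_of_torsionIso)
    (hPR : PollackRubin2004.mainTheorem_signedCharIdeal_eq_of_cm)
    (hmod : nonempty_modularParametrizationData)
    (hF : thm132_fiveCongruent_hessePencil)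
    (W A : WeierstrassCurve ℚ) [W.IsElliptic] [W.IsGloballyMinimal] [A.IsElliptic] [A.IsGloballyMinimal]
    [Fact (Nat.Prime 5)] (hW : W = ⟨0, 0, 0, -19194180, 32367000792⟩) (hA : A = ⟨0, 0, 0, 0, -32⟩)
    (hPollack : ∀ {N : ℕ} [NeZero N] {f : CuspForm (Gamma0 N) 2},
      pollack_exists_plusMinusPAdicLFunction (W := A) (f := f) (p := 5))
    [NeZero (W.conductorNorm ℤ)] {f₀ : CuspForm (Gamma0 (W.conductorNorm ℤ)) 2} (hf₀ : IsNewformOf W f₀)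
    [NeZero (A.conductorNorm ℤ)] {f₀' : CuspForm (Gamma0 (A.conductorNorm ℤ)) 2} (hf₀' : IsNewformOf A f₀')
    (ε : ℤˣ) {Θ Θ' : IwasawaAlgebra 5} (hΘ0 : Θ ≠ 0) (hμ : mu Θ = 0) (hΘ'0 : Θ' ≠ 0) (hμ' : mu Θ' = 0)
    (hrow : (ε = -1 ∧
        iwasawaToPowerSeries 5 Θ = ((mazurTateElement f₀ 5 1).map (algebraMap ℚ ℚ_[5]) : PowerSeries ℚ_[5]) ∧
        lam Θ = (cyclotomicOmegaPlus 5 1).natDegree + 0 ∧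
        iwasawaToPowerSeries 5 Θ' = ((mazurTateElement f₀' 5 1).map (algebraMap ℚ ℚ_[5]) : PowerSeries ℚ_[5]) ∧
        lam Θ' = (cyclotomicOmegaPlus 5 1).natDegree + 0) ∨
      (ε = 1 ∧
        iwasawaToPowerSeries 5 Θ = ((mazurTateElement f₀ 5 2).map (algebraMap ℚ ℚ_[5]) : PowerSeries ℚ_[5]) ∧
        lam Θ = (cyclotomicOmegaMinus 5 2).natDegree + 0 ∧
        iwasawaToPowerSeries 5 Θ' = ((mazurTateElement f₀' 5 2).map (algebraMap ℚ ℚ_[5]) : PowerSeries ℚ_[5]) ∧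
        lam Θ' = (cyclotomicOmegaMinus 5 2).natDegree + 0)) :
    KobayashiMainConjecture W 5 ε := by
  have hI : integralModelInt W = ⟨0, 0, 0, -19194180, 32367000792⟩ :=
    integralModelInt_eq_of_map_eq _ (by rw [hW]; ext <;> simp [WeierstrassCurve.map])
  have hI' : integralModelInt A = ⟨0, 0, 0, 0, -32⟩ :=
    integralModelInt_eq_of_map_eq _ (by rw [hA]; ext <;> simp [WeierstrassCurve.map])
  have hp2 : (5 : ℕ) ≠ 2 := by decide
  have hSS : GoodSS W 5 := goodSS_of_intModel 5 hI (by decide) Summit.BirchSwinnertonDyer.BirchSwinnertonDyer.Theorems.card_c105408z1_5 (by norm_num)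
  have hap : W.frobeniusTrace 5 = 0 := by rw [frobeniusTrace_eq hI Summit.BirchSwinnertonDyer.BirchSwinnertonDyer.Theorems.card_c105408z1_5]; norm_num
  have hSS' : GoodSS A 5 := goodSS_of_intModel 5 hI' (by decide) Summit.BirchSwinnertonDyer.BirchSwinnertonDyer.Theorems.card_cm0m32_5 (by norm_num)
  have hap' : A.frobeniusTrace 5 = 0 := by rw [frobeniusTrace_eq hI' Summit.BirchSwinnertonDyer.BirchSwinnertonDyer.Theorems.card_cm0m32_5]; norm_num
  have hcm' : A.HasCM := Summit.BirchSwinnertonDyer.BirchSwinnertonDyer.Theorems.hasCM_cm0m32 hI'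
  have hc4 : W.c₄ = (921320640 : ℚ) := by
    subst hW; norm_num [WeierstrassCurve.c₄, WeierstrassCurve.b₂, WeierstrassCurve.b₄]
  have hc6 : W.c₆ = (-27965088684288 : ℚ) := by
    subst hW; norm_num [WeierstrassCurve.c₆, WeierstrassCurve.b₂, WeierstrassCurve.b₄, WeierstrassCurve.b₆]
  have hc4A : A.c₄ = (0 : ℚ) := by
    subst hA; norm_num [WeierstrassCurve.c₄, WeierstrassCurve.b₂, WeierstrassCurve.b₄]
  have hc6A : A.c₆ = (27648 : ℚ) := by
    subst hA; norm_num [WeierstrassCurve.c₆, WeierstrassCurve.b₂, WeierstrassCurve.b₄, WeierstrassCurve.b₆]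
  -- the 5-congruence `E[5] ≃ A[5]` as a THEOREM (Fisher's pencil of `A` through `E`), kernel-checked
  have he := fiveCongruent_of_hesseCertificate hF A W (-96 : ℚ) (1 : ℚ) (1019215872 : ℚ)
    (by norm_num) (by rw [hc4A, hc6A, hc4, eval_hesseC4]; norm_num)
    (by rw [hc4A, hc6A, hc6, eval_hesseC6]; norm_num)
  obtain ⟨S₀, hS₀, hS₀W, hS₀A, hsumW, hsumA⟩ := places_105408z1_5 W A hW hA
  rcases hrow with ⟨rfl, hΘ, hlam, hΘ', hlam'⟩ | ⟨rfl, hΘ, hlam, hΘ', hlam'⟩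
  · exact kobayashiMainConjecture_neg_one_of_cmPartner_of_mazurTate h12 h41 h5 h3 h09 hKim hPR hmod hp2 hSS.1
      hap hf₀ (by decide) hΘ hΘ0 hμ hlam hPollack hcm' hSS' hap' he hf₀' (by decide) hΘ' hΘ'0 hμ' hlam' S₀
      hS₀ hS₀W hS₀A (by rw [hsumW, hsumA])
  · exact kobayashiMainConjecture_one_of_cmPartner_of_mazurTate h12 h41 h5 h3 h09 hKim hPR hmod hp2 hSS.1
      hap hf₀ (by decide) hΘ hΘ0 hμ hlam hPollack hcm' hSS' hap' he hf₀' (by decide) hΘ' hΘ'0 hμ' hlam' S₀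
      hS₀ hS₀W hS₀A (by rw [hsumW, hsumA])

/-- **Item 4's statement AT THE PAIR `105408z1 @ 5`**: `∃ ε, KobayashiMainConjecture W 5 ε`, from `lam4_kobayashiMainConjecture_105408z1_5` with
the `ε = -1` rows. PER PAIR; the crux is untouched; nothing booked. [cite: Kobayashi2003, Conjecture (p. 2) and Thm. 4.1] [cite: BDKim2009, Cor. 2.13 (p. 187)]
[cite: Cremona2006, Table 1 (Cremona label 105408z1)] -/
theorem lam4_exists_kobayashiMainConjecture_105408z1_5
    (h12 : Kobayashi2003.thm12_signedSelmerDual_finite_torsion)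
    (h41 : Kobayashi2003.thm41_signedCharIdeal_divisibility)
    (h5 : realPeriodRat_eq_unit_mul_plusPeriod) (h3 : realPeriodRat_eq_unit_mul_plusPeriod_three)
    (h09 : cor213_signedMu_eq_zero_iff_of_torsionIso)
    (hKim : BDKim2009.cor213_signedLambda_add_sum_delta_eq_of_torsionIso)
    (hPR : PollackRubin2004.mainTheorem_signedCharIdeal_eq_of_cm)
    (hmod : nonempty_modularParametrizationData)
    (hF : thm132_fiveCongruent_hessePencil)
    (W A : WeierstrassCurve ℚ) [W.IsElliptic] [W.IsGloballyMinimal] [A.IsElliptic] [A.IsGloballyMinimal]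
    [Fact (Nat.Prime 5)] (hW : W = ⟨0, 0, 0, -19194180, 32367000792⟩) (hA : A = ⟨0, 0, 0, 0, -32⟩)
    (hPollack : ∀ {N : ℕ} [NeZero N] {f : CuspForm (Gamma0 N) 2},
      pollack_exists_plusMinusPAdicLFunction (W := A) (f := f) (p := 5))
    [NeZero (W.conductorNorm ℤ)] {f₀ : CuspForm (Gamma0 (W.conductorNorm ℤ)) 2} (hf₀ : IsNewformOf W f₀)
    [NeZero (A.conductorNorm ℤ)] {f₀' : CuspForm (Gamma0 (A.conductorNorm ℤ)) 2} (hf₀' : IsNewformOf A f₀')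
    {Θ Θ' : IwasawaAlgebra 5}
    (hΘ : iwasawaToPowerSeries 5 Θ = ((mazurTateElement f₀ 5 1).map (algebraMap ℚ ℚ_[5]) : PowerSeries ℚ_[5]))
    (hΘ0 : Θ ≠ 0) (hμ : mu Θ = 0) (hlam : lam Θ = (cyclotomicOmegaPlus 5 1).natDegree + 0)
    (hΘ' : iwasawaToPowerSeries 5 Θ' = ((mazurTateElement f₀' 5 1).map (algebraMap ℚ ℚ_[5]) : PowerSeries ℚ_[5]))
    (hΘ'0 : Θ' ≠ 0) (hμ' : mu Θ' = 0) (hlam' : lam Θ' = (cyclotomicOmegaPlus 5 1).natDegree + 0) :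
    ∃ ε : ℤˣ, KobayashiMainConjecture W 5 ε :=
  ⟨-1, lam4_kobayashiMainConjecture_105408z1_5 h12 h41 h5 h3 h09 hKim hPR hmod hF W A hW hA hPollack hf₀ hf₀'
    (-1) hΘ0 hμ hΘ'0 hμ' (Or.inl ⟨rfl, hΘ, hlam, hΘ', hlam'⟩)⟩

/-- **`BSD(E,5)` for `105408z1`** (X7, `r_an = 0`, `5Nn`; desk cell `residue; [(5,'X7')]` (OPEN) on referee A's newest state `scratchA_A_state_after_jsw17addC_onR662_fold.pkl` sha16 89410861d70c61c4 (read-only look-up 2026-08-27T09:50Z)) **through the IMAGE-FREE rank-0 road**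
`bsdp_of_kobayashiMainConjecture_of_analyticRank_eq_zero` (Kobayashi Thm. 1.2 `h12`, B. D. Kim 2013 Cor. 3.15 `hKim13`, Pollack `hPollackW`,
modularity `hmod`/`hmod'`, GZK `hGZK`) fed with `lam4_kobayashiMainConjecture_105408z1_5` (`ε = -1` rows); the rank datum `hr : r_an = 0` (Cremona)
is displayed; class X7 decided in the kernel (good supersingular at `5`, additive at `2`). NO descent certificate, NO `BSDp` input, NO preprint.
PER PAIR; nothing booked; BSD is not proved by any of this.
[cite: Kobayashi2003, Thm. 1.2 and Conjecture (p. 2)] [cite: BDKim2013, Cor. 3.15 (p. 199)] [cite: BDKim2009, Cor. 2.13 (p. 187)]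
[cite: Miller2011LMS, Def. 1.1] [cite: Cremona2006, Table 1 (Cremona label 105408z1)] -/
theorem lam4_bsdp_105408z1_5
    (h12 : Kobayashi2003.thm12_signedSelmerDual_finite_torsion)
    (h41 : Kobayashi2003.thm41_signedCharIdeal_divisibility)
    (h5 : realPeriodRat_eq_unit_mul_plusPeriod) (h3 : realPeriodRat_eq_unit_mul_plusPeriod_three)
    (h09 : cor213_signedMu_eq_zero_iff_of_torsionIso)
    (hKim : BDKim2009.cor213_signedLambda_add_sum_delta_eq_of_torsionIso)
    (hPR : PollackRubin2004.mainTheorem_signedCharIdeal_eq_of_cm)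
    (hmod : nonempty_modularParametrizationData)
    (hF : thm132_fiveCongruent_hessePencil) (hmod' : hasEntireLFunction_rat)
    (hKim13 : BDKim2013.cor315_signedCharValue_rankZero)
    (hGZK : rank_eq_analyticRank_of_analyticRank_le_one)
    (W A : WeierstrassCurve ℚ) [W.IsElliptic] [W.IsGloballyMinimal] [A.IsElliptic] [A.IsGloballyMinimal]
    [Fact (Nat.Prime 5)] (hW : W = ⟨0, 0, 0, -19194180, 32367000792⟩) (hA : A = ⟨0, 0, 0, 0, -32⟩)
    (hr : W.analyticRank = 0)
    (hPollack : ∀ {N : ℕ} [NeZero N] {f : CuspForm (Gamma0 N) 2},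
      pollack_exists_plusMinusPAdicLFunction (W := A) (f := f) (p := 5))
    (hPollackW : ∀ {N : ℕ} [NeZero N] {f : CuspForm (Gamma0 N) 2},
      pollack_exists_plusMinusPAdicLFunction (W := W) (f := f) (p := 5))
    [NeZero (W.conductorNorm ℤ)] {f₀ : CuspForm (Gamma0 (W.conductorNorm ℤ)) 2} (hf₀ : IsNewformOf W f₀)
    [NeZero (A.conductorNorm ℤ)] {f₀' : CuspForm (Gamma0 (A.conductorNorm ℤ)) 2} (hf₀' : IsNewformOf A f₀')
    {Θ Θ' : IwasawaAlgebra 5}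
    (hΘ : iwasawaToPowerSeries 5 Θ = ((mazurTateElement f₀ 5 1).map (algebraMap ℚ ℚ_[5]) : PowerSeries ℚ_[5]))
    (hΘ0 : Θ ≠ 0) (hμ : mu Θ = 0) (hlam : lam Θ = (cyclotomicOmegaPlus 5 1).natDegree + 0)
    (hΘ' : iwasawaToPowerSeries 5 Θ' = ((mazurTateElement f₀' 5 1).map (algebraMap ℚ ℚ_[5]) : PowerSeries ℚ_[5]))
    (hΘ'0 : Θ' ≠ 0) (hμ' : mu Θ' = 0) (hlam' : lam Θ' = (cyclotomicOmegaPlus 5 1).natDegree + 0) :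
    BSDp W 5 := by
  have hI : integralModelInt W = ⟨0, 0, 0, -19194180, 32367000792⟩ :=
    integralModelInt_eq_of_map_eq _ (by rw [hW]; ext <;> simp [WeierstrassCurve.map])
  have hp2 : (5 : ℕ) ≠ 2 := by decide
  have hX : ClassX7 W 5 :=
    classX7_of_intModel 5 hI (by decide) Summit.BirchSwinnertonDyer.BirchSwinnertonDyer.Theorems.card_c105408z1_5 (by norm_num) 2 Nat.prime_two (by decide) (by decide)
  have hap : W.frobeniusTrace 5 = 0 := by rw [frobeniusTrace_eq hI Summit.BirchSwinnertonDyer.BirchSwinnertonDyer.Theorems.card_c105408z1_5]; norm_num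
  exact bsdp_of_kobayashiMainConjecture_of_analyticRank_eq_zero W 5 h12 hKim13 hPollackW hmod hmod' hGZK hp2
    hX.1.1 hap (ClassX7.irr W 5 hp2 hX) hr
    (lam4_kobayashiMainConjecture_105408z1_5 h12 h41 h5 h3 h09 hKim hPR hmod hF W A hW hA hPollack hf₀ hf₀' (-1)
      hΘ0 hμ hΘ'0 hμ' (Or.inl ⟨rfl, hΘ, hlam, hΘ', hlam'⟩))

end Summit.BirchSwinnertonDyer.BirchSwinnertonDyer.Theorems.SmallImageCongruenceRoad

end
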